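import Summits.BirchSwinnertonDyer.Rank1Residual.X11b.PropagatedUnramified
import Literature.NumberTheory.GaloisRepresentations.TateLevelOneFiniteSupport
import Literature.NumberTheory.GaloisRepresentations.LocalFieldCdTwo
import Literature.NumberTheory.EllipticCurves.HasseWeilGoodReduction
import Literature.NumberTheory.EllipticCurves.WeilPairingTateDual
import Mathlib.RingTheory.DedekindDomain.Factorization
import HarnessLib

/-!
# X11b, route R1 — a class of `H²(K, E[p^k])` is LOCALLY ZERO at all but finitely many places
# (finite support of `β²`, towards `Ш²` and atom (L10))

HONEST FRAMING (cell `b2b-bsdres`, run/shared/lean/b2b/bsd-rank1-residual/, verbatim in every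
file): the goal of the cell is to DELETE the COMBINATION-SHAPED residual classes of the
Birch–Swinnerton-Dyer formula for ALL analytic-rank `≤ 1` elliptic curves over `ℚ` — "full BSD
formula for every rank `≤ 1` curve in class `C`" assembled STRICTLY from published theorems — so
that the rank-`≤ 1` remainder becomes exactly the CONSTRUCTION-SHAPED classes, which are TYPED
(missing-input `Prop`s), NOT attempted. This is not "finishing BSD". Sub-cell
`b2b-bsdres-multr1-p1` (X11b, route R1 = Castella 2018 Thm. A re-proved along the author's
erratum); a RESEARCH ROUTE; no claim beyond the stated class; X11b stays CONSTRUCTION-SHAPED;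
nothing here changes a label; no named fact is minted (one auxiliary definition with a body — the
descent of a `2`-cocycle to the unramified quotient — and theorems; no `sorry`).

## What this file does

JSW17 Lemma 3.3.3 passes from `H²(K^S/K, W)` to `Ш²_S(K, W)`; in the tree's all-places /
absolute-Galois-group vocabulary (`DiscreteGaloisModule.shaTwo`, `PoitouTateSha.lean`) the
corresponding input is Milne I Lemma 4.8 / Harari Prop. 17.6: **a class of `H²(K, M)` for a finite
module `M` has `loc_v = 0` at all but finitely many places** (the tree's named fact
`poitouTate_sha_zmod_mu` carries this clause for `M = ℤ/m` only). Here it is PROVED for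
`M = E[p^k]` (indeed the local step for any finite discrete module), following the pattern of
`TateLevelOneFiniteSupport.lean` (Serre §6.5 (c) for `ℚ/ℤ`) but with the cyclic splitting replaced by
the tree's **`cd(Γ_{K_v}/I_{K_v}) ≤ 1`** (`LocalFieldCdTwo.subsingleton_two_quotient_galUnr_of_finite`):

* `twoCocycleClass_eq_zero_of_biinvariant_of_absInertia_le` (local, any non-archimedean local
  field `F` of characteristic `0`, any finite discrete `Γ_F`-module `B`): a continuous `2`-cocycle
  that is bi-invariant under an open normal `U ⊇ I_F` acting trivially on `B` has trivial class —
  it descends to `Γ_F ⧸ Gal(F̄/F^nr)` (`descendTwoCocycle`), where `H²` of finite modules vanishes;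
* `localization_two_twoCocycleClass` (the localisation of a class on cocycles);
* **`eventually_localization_two_torsion_eq_zero`**: for an elliptic curve `E/K` over a number
  field and `x ∈ H²(K, E[p^k])`, `loc_v x = 0` for all but finitely many finite places `v`
  (uniform local constancy of the cocycle on the profinite `Γ_K`; a finite Galois `E'/K` inside the
  open normal subgroup; inertia at almost all `v` fixes `E'` (`eventually_forall_inertia_mem_fixingSubgroup`);
  good reduction and `v ∤ p` almost everywhere, where `I_{K_v}` acts trivially on `E[p^k]`
  (`restrictField_torsionGaloisModule_apply_of_mem_absInertia`)).

References: [MilneADT2006] I Lemma 4.8; [Harari2020] Prop. 17.6, Lemma 17.8;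
[JetchevSkinnerWan2017] Lemma 3.3.3 (arXiv:1512.06894 p. 12); [SerreGaloisCohomology1997] II §4.3.
-/

noncomputable section

open scoped Classical

open CategoryTheory Field NumberField IsDedekindDomain Topology
open Literature.NumberTheory.EllipticCurves
open Literature.NumberTheory.GaloisRepresentations
open scoped ContRepresentation

universe u

-- `H²` needs `LocallyCompactSpace Γ`; compactness of absolute Galois groups as a local instance.
attribute [local instance] absoluteGaloisGroup_compactSpace

namespace Summit.BirchSwinnertonDyer.Rank1Residual.X11b.H2Support

/-! ## §1. Local: bi-invariant `2`-cocycles through an unramified quotient have trivial class -/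

section Local

variable (F : Type u) [Field F] [ValuativeRel F] [TopologicalSpace F] [IsNonarchimedeanLocalField F]
variable {B : Type u} [AddCommGroup B] [TopologicalSpace B] [DiscreteTopology B]
  (τ : ContinuousRep (absoluteGaloisGroup F) ℤ B)

omit [DiscreteTopology B] in
/-- Every element of `B` is invariant under `N = Gal(F̄/F^nr)` when an overgroup `U ⊇ I_F = N` acts
trivially. [folklore] -/
theorem mem_invariantsOf_galUnr (U : Subgroup (absoluteGaloisGroup F)) (hIU : absInertia F ≤ U)
    (hUB : ∀ u ∈ U, ∀ b : B, τ u b = b) (b : B) : b ∈ τ.invariantsOf (galUnr F) := by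
  rw [ContinuousRep.mem_invariantsOf_iff]
  intro n
  exact hUB _ (hIU (by rw [← galUnr_eq_absInertia]; exact n.2)) b

variable {F τ}

/-- **Descent of a bi-invariant `2`-cocycle to the unramified quotient** `Q = Γ_F ⧸ Gal(F̄/F^nr)`,
with values in `B^N = B` for the quotient module `τ.quotientInvariants N`: the function
`(x, y) ↦ z(x̃, ỹ)` on representatives (well defined by bi-invariance under `U ⊇ N`, continuous
because `Γ_F × Γ_F → Q × Q` is an open quotient map). [folklore] -/
def descendTwoCocycle (U : Subgroup (absoluteGaloisGroup F)) (hIU : absInertia F ≤ U)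
    (hUB : ∀ u ∈ U, ∀ b : B, τ u b = b) (z : contTwoCocycles τ.toTopRep)
    (hz : ∀ σ ρ, ∀ u₁ ∈ U, ∀ u₂ ∈ U, z.1 (σ * u₁, ρ * u₂) = z.1 (σ, ρ)) :
    contTwoCocycles (τ.quotientInvariants (galUnr F)).toTopRep := by
  -- the descended function on representatives
  let N := galUnr F
  have hNU : N ≤ U := fun n hn ↦ hIU (by rw [← galUnr_eq_absInertia]; exact hn)
  let g : (absoluteGaloisGroup F ⧸ N) → (absoluteGaloisGroup F ⧸ N) → τ.invariantsOf N :=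
    fun x y ↦ ⟨z.1 (Quotient.out x, Quotient.out y), mem_invariantsOf_galUnr F τ U hIU hUB _⟩
  have hg : ∀ σ ρ : absoluteGaloisGroup F,
      g (QuotientGroup.mk σ) (QuotientGroup.mk ρ) = ⟨z.1 (σ, ρ), mem_invariantsOf_galUnr F τ U hIU hUB _⟩ := by
    intro σ ρ
    obtain ⟨n₁, hn₁⟩ := QuotientGroup.mk_out_eq_mul N σ
    obtain ⟨n₂, hn₂⟩ := QuotientGroup.mk_out_eq_mul N ρ
    apply Subtype.ext
    change z.1 (Quotient.out (QuotientGroup.mk σ : absoluteGaloisGroup F ⧸ N),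
      Quotient.out (QuotientGroup.mk ρ : absoluteGaloisGroup F ⧸ N)) = z.1 (σ, ρ)
    rw [hn₁, hn₂]
    exact hz σ ρ n₁ (hNU n₁.2) n₂ (hNU n₂.2)
  -- continuity
  have hcont : Continuous (Function.uncurry g) := by
    have hq : IsOpenQuotientMap (Prod.map (QuotientGroup.mk : absoluteGaloisGroup F → _ ⧸ N)
        (QuotientGroup.mk : absoluteGaloisGroup F → _ ⧸ N)) :=
      QuotientGroup.isOpenQuotientMap_mk.prodMap QuotientGroup.isOpenQuotientMap_mk
    rw [← hq.continuous_comp_iff]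
    have e : Function.uncurry g ∘ Prod.map QuotientGroup.mk QuotientGroup.mk =
        fun στ : absoluteGaloisGroup F × absoluteGaloisGroup F ↦
          (⟨z.1 στ, mem_invariantsOf_galUnr F τ U hIU hUB _⟩ : τ.invariantsOf N) := by
      funext στ
      exact hg στ.1 στ.2
    rw [e]
    exact z.1.continuous.subtype_mk _
  refine ⟨⟨Function.uncurry g, hcont⟩, fun x y w ↦ ?_⟩
  obtain ⟨σ, rfl⟩ := QuotientGroup.mk_surjective x
  obtain ⟨ρ, rfl⟩ := QuotientGroup.mk_surjective y
  obtain ⟨υ, rfl⟩ := QuotientGroup.mk_surjective w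
  change (τ.quotientInvariants N) (QuotientGroup.mk σ) (g (QuotientGroup.mk ρ) (QuotientGroup.mk υ)) +
      g (QuotientGroup.mk σ) (QuotientGroup.mk ρ * QuotientGroup.mk υ) =
    g (QuotientGroup.mk σ * QuotientGroup.mk ρ) (QuotientGroup.mk υ) +
      g (QuotientGroup.mk σ) (QuotientGroup.mk ρ)
  rw [← QuotientGroup.mk_mul, ← QuotientGroup.mk_mul, hg, hg, hg, hg]
  apply Subtype.ext
  change τ σ (z.1 (ρ, υ)) + z.1 (σ, ρ * υ) = z.1 (σ * ρ, υ) + z.1 (σ, ρ)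
  exact z.2 σ ρ υ

/-- Values of the descended cocycle on classes. [folklore] -/
theorem descendTwoCocycle_apply_mk (U : Subgroup (absoluteGaloisGroup F)) (hIU : absInertia F ≤ U)
    (hUB : ∀ u ∈ U, ∀ b : B, τ u b = b) (z : contTwoCocycles τ.toTopRep)
    (hz : ∀ σ ρ, ∀ u₁ ∈ U, ∀ u₂ ∈ U, z.1 (σ * u₁, ρ * u₂) = z.1 (σ, ρ)) (σ ρ : absoluteGaloisGroup F) :
    ((descendTwoCocycle U hIU hUB z hz).1 (QuotientGroup.mk σ, QuotientGroup.mk ρ) :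
      τ.invariantsOf (galUnr F)) = ⟨z.1 (σ, ρ), mem_invariantsOf_galUnr F τ U hIU hUB _⟩ := by
  have hNU : galUnr F ≤ U := fun n hn ↦ hIU (by rw [← galUnr_eq_absInertia]; exact hn)
  obtain ⟨n₁, hn₁⟩ := QuotientGroup.mk_out_eq_mul (galUnr F) σ
  obtain ⟨n₂, hn₂⟩ := QuotientGroup.mk_out_eq_mul (galUnr F) ρ
  apply Subtype.ext
  change z.1 (Quotient.out (QuotientGroup.mk σ : absoluteGaloisGroup F ⧸ galUnr F),
    Quotient.out (QuotientGroup.mk ρ : absoluteGaloisGroup F ⧸ galUnr F)) = z.1 (σ, ρ)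
  rw [hn₁, hn₂]
  exact hz σ ρ n₁ (hNU n₁.2) n₂ (hNU n₂.2)

/-- **A `2`-cocycle of `Γ_F` with values in a finite module, bi-invariant under an open normal
subgroup `U ⊇ I_F` acting trivially, has trivial class** (`F` a non-archimedean local field of
characteristic `0`): it descends to `Γ_F ⧸ Gal(F̄/F^nr)`, whose `H²` with finite coefficients
vanishes (`cd ≤ 1`, tree `subsingleton_two_quotient_galUnr_of_finite`), and the splitting cochain
pulls back. This is "`α_v = 0` at an unramified place" (Milne I Lemma 4.8; Serre §6.5 (c) (i)) for
non-trivial unramified coefficients. [cite: MilneADT2006, Ch. I §4, Lemma 4.8]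
[cite: SerreGaloisCohomology1997, II §4.3 Prop. 12 (cd(Ẑ) = 1)] -/
theorem twoCocycleClass_eq_zero_of_biinvariant_of_absInertia_le [Finite B]
    (U : Subgroup (absoluteGaloisGroup F)) (hIU : absInertia F ≤ U)
    (hUB : ∀ u ∈ U, ∀ b : B, τ u b = b) (z : contTwoCocycles τ.toTopRep)
    (hz : ∀ σ ρ, ∀ u₁ ∈ U, ∀ u₂ ∈ U, z.1 (σ * u₁, ρ * u₂) = z.1 (σ, ρ)) :
    twoCocycleClass τ.toTopRep z = 0 := by
  haveI : Subsingleton (continuousCohomology 2 (τ.quotientInvariants (galUnr F)).toTopRep) :=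
    subsingleton_two_quotient_galUnr_of_finite F _ (τ.quotientInvariants (galUnr F))
  have h0 : twoCocycleClass _ (descendTwoCocycle U hIU hUB z hz) = 0 := Subsingleton.elim _ _
  rw [twoCocycleClass_eq_zero_iff] at h0
  obtain ⟨b, hb⟩ := h0
  rw [twoCocycleClass_eq_zero_iff]
  let π : absoluteGaloisGroup F → absoluteGaloisGroup F ⧸ galUnr F := QuotientGroup.mk
  refine ⟨⟨fun σ ↦ ((b (π σ) : τ.invariantsOf (galUnr F)) : B),
    continuous_subtype_val.comp (b.continuous.comp continuous_quot_mk)⟩, fun σ ρ ↦ ?_⟩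
  have h := congrArg (fun w : τ.invariantsOf (galUnr F) ↦ (w : B)) (hb (π σ) (π ρ))
  simp only at h
  rw [descendTwoCocycle_apply_mk] at h
  change z.1 (σ, ρ) = _ at h
  rw [h]
  change ((τ.quotientInvariants (galUnr F) (QuotientGroup.mk σ) (b (π ρ)) : τ.invariantsOf (galUnr F)) : B)
      - (b (π σ * π ρ) : B) + (b (π σ) : B) =
    τ σ (b (π ρ) : B) - (b (π (σ * ρ)) : B) + (b (π σ) : B)
  rw [ContinuousRep.quotientInvariants_apply_coe]
  rfl

end Local

/-! ## §2. Global: localisation on cocycles, and the finiteness of the support for `E[p^k]` -/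

section Global

variable {K : Type u} [Field K] [NumberField K]

/-- Only finitely many finite places of a number field lie above a nonzero natural number `n`.
[folklore] -/
theorem finite_setOf_natCast_mem (n : ℕ) (hn : n ≠ 0) :
    {v : HeightOneSpectrum (𝓞 K) | (n : 𝓞 K) ∈ v.asIdeal}.Finite := by
  have hI : Ideal.span {(n : 𝓞 K)} ≠ ⊥ := by
    rw [Ne, Ideal.span_singleton_eq_bot]
    exact_mod_cast hn
  refine (Ideal.finite_factors hI).subset fun v hv => ?_
  simp only [Set.mem_setOf_eq] at hv ⊢
  exact (Ideal.dvd_span_singleton).mpr hv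

variable {M : Type u} [AddCommGroup M] [TopologicalSpace M] [DiscreteTopology M]

/-- **Localisation on `2`-cocycles**: `loc_v [c] = [c ∘ (res_v × res_v)]` at a finite place `v`.
Serre, *Galois Cohomology*, I §2.4. [folklore] -/
theorem localization_two_twoCocycleClass (ρ : DiscreteGaloisModule K M) (v : HeightOneSpectrum (𝓞 K))
    (c : contTwoCocycles ρ.toTopRep) :
    galoisCohomology.localization ρ (Sum.inr v) 2 (twoCocycleClass ρ.toTopRep c) =
      twoCocycleClass (DiscreteGaloisModule.toTopRep (ρ.toLocal (Sum.inr v)))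
        (contTwoCocycles.pullback (absGaloisRestrict K (v.adicCompletion K)) (X := ρ.toTopRep)
          (Y := DiscreteGaloisModule.toTopRep (ρ.toLocal (Sum.inr v)))
          (TopRep.ofHom ⟨ContinuousLinearMap.id ℤ M, fun _ => rfl⟩) c) :=
  map_twoCocycleClass _ _ _ c

variable (W : WeierstrassCurve K) [W.IsElliptic] (p : ℕ) [Fact p.Prime] (k : ℕ)

/-- **A class of `H²(K, E[p^k])` is locally zero at all but finitely many finite places** (Milne I
Lemma 4.8 / Harari Prop. 17.6 "the image of `β²` lies in `⊕_v H²(k_v, M)`", for `M = E[p^k]`):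
the cocycle is bi-invariant under an open normal subgroup `N ⊴ Γ_K` acting trivially on `E[p^k]`;
`N` contains `Gal(K̄/E')` for a finite Galois `E'`; at the cofinitely many `v` with inertia fixing
`E'`, good reduction and `v ∤ p`, the restricted cocycle is bi-invariant under `res⁻¹(N) ⊇ I_{K_v}`
acting trivially, hence has trivial class (`twoCocycleClass_eq_zero_of_biinvariant_of_absInertia_le`).
[cite: MilneADT2006, Ch. I §4, Lemma 4.8] [cite: Harari2020, Prop. 17.6 and Lemma 17.8] -/
theorem eventually_localization_two_torsion_eq_zero
    (x : galoisCohomology (W.torsionGaloisModule ((p ^ k : ℕ) : ℤ)) 2) :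
    ∀ᶠ v : HeightOneSpectrum (𝓞 K) in Filter.cofinite,
      galoisCohomology.localization (W.torsionGaloisModule ((p ^ k : ℕ) : ℤ)) (Sum.inr v) 2 x = 0 := by
  classical
  have hprime : p.Prime := Fact.out
  haveI : NeZero (p ^ k) := ⟨pow_ne_zero k hprime.ne_zero⟩
  haveI : Finite (W.geomTorsion ((p ^ k : ℕ) : ℤ)) := finite_geomTorsion_of_neZero W (p ^ k)
  obtain ⟨c, hc⟩ := twoCocycleClass_surjective _ x
  -- uniform local constancy of the cocycle, and triviality of the action, on an open normal `N`
  have hg : IsLocallyConstant (Function.uncurry fun σ τ ↦ c.1 (σ, τ)) :=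
    (IsLocallyConstant.iff_continuous _).2 c.1.continuous
  obtain ⟨N₀, hN₀⟩ := exists_openNormalSubgroup_forall_mul_eq_of_isLocallyConstant₂ hg
  have hSopen : IsOpen {σ : absoluteGaloisGroup K |
      ∀ m : W.geomTorsion ((p ^ k : ℕ) : ℤ), W.torsionGaloisModule ((p ^ k : ℕ) : ℤ) σ m = m} := by
    have e : {σ : absoluteGaloisGroup K |
        ∀ m : W.geomTorsion ((p ^ k : ℕ) : ℤ), W.torsionGaloisModule ((p ^ k : ℕ) : ℤ) σ m = m} =
        ⋂ m, {σ | W.torsionGaloisModule ((p ^ k : ℕ) : ℤ) σ m = m} := by ext σ; simp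
    rw [e]
    exact isOpen_iInter_of_finite fun m ↦
      (W.torsionGaloisModule ((p ^ k : ℕ) : ℤ)).isOpen_setOf_apply_eq m
  obtain ⟨N, hN⟩ := ProfiniteGrp.exist_openNormalSubgroup_sub_open_nhds_of_one
    (hSopen.inter N₀.isOpen) ⟨fun m ↦ by rw [map_one]; rfl, N₀.one_mem⟩
  have hNρ : ∀ σ ∈ N, ∀ m, W.torsionGaloisModule ((p ^ k : ℕ) : ℤ) σ m = m :=
    fun σ hσ ↦ (hN hσ).1
  have hNN₀ : ∀ σ ∈ N, σ ∈ N₀ := fun σ hσ ↦ (hN hσ).2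
  -- a finite Galois `E'` with `Gal(K̄/E') ≤ N`
  obtain ⟨E, hEfin, hEgal, hE⟩ := exists_isGalois_mem_of_restrict_eq_one K N.isOpen N.one_mem
  haveI := hEfin
  haveI := hEgal
  -- the three cofinite conditions
  have hp' : ∀ᶠ v : HeightOneSpectrum (𝓞 K) in Filter.cofinite, (p : 𝓞 K) ∉ v.asIdeal := by
    rw [Filter.eventually_cofinite]
    simpa only [not_not] using finite_setOf_natCast_mem (K := K) p hprime.ne_zero
  filter_upwards [eventually_forall_inertia_mem_fixingSubgroup (F := K) E,
    W.eventually_hasGoodReductionAt, hp'] with v hv hgood hpv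
  set F := v.adicCompletion K with hF
  set r := absGaloisRestrict K F with hr_def
  -- `res (I_{K_v}) ≤ N`
  have hIN : ∀ ι ∈ absInertia F, r ι ∈ N := by
    intro ι hι
    have h1 : r ι ∈ (adicCompletionPrime K v).inertia (absoluteGaloisGroup K) := by
      rw [inertia_adicCompletionPrime_eq_map_absInertia K v]
      exact Subgroup.mem_map_of_mem _ hι
    have h2 := hv _ (adicCompletionPrime_mem_primesAbove K v) _ h1
    apply hE
    have h3 : r ι ∈ (absRestrictNormalHom (K := K) E).ker := by
      change absoluteGaloisGroup.toAlgEquiv K (r ι) ∈ (AlgEquiv.restrictNormalHom E).ker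
      rw [IntermediateField.restrictNormalHom_ker]
      exact h2
    exact h3
  -- the open normal subgroup `U = res⁻¹(N) ⊇ I_{K_v}` of `Γ_{K_v}`
  set U : Subgroup (absoluteGaloisGroup F) := N.toSubgroup.comap r.toMonoidHom with hU_def
  haveI : U.Normal := Subgroup.Normal.comap inferInstance _
  have hIU : absInertia F ≤ U := fun ι hι ↦ hIN ι hι
  -- the local module and the restricted cocycle
  rw [← hc, localization_two_twoCocycleClass]
  refine twoCocycleClass_eq_zero_of_biinvariant_of_absInertia_le (F := F)
    (τ := GaloisRep.restrictField F (W.torsionGaloisModule ((p ^ k : ℕ) : ℤ)))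
    U hIU (fun u hu m ↦ ?_) _ (fun σ τ u₁ hu₁ u₂ hu₂ ↦ ?_)
  · -- `U` acts trivially on `E[p^k]`
    exact hNρ (r u) hu m
  · -- bi-invariance of the restricted cocycle
    change c.1 (r (σ * u₁), r (τ * u₂)) = c.1 (r σ, r τ)
    rw [map_mul, map_mul]
    exact hN₀ (r σ) (r τ) (r u₁) (hNN₀ _ hu₁) (r u₂) (hNN₀ _ hu₂)

end Global

end Summit.BirchSwinnertonDyer.Rank1Residual.X11b.H2Support

end
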